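import Summits.BirchSwinnertonDyer.Rank1Residual.X11b.ShapiroPairs
import HarnessLib

/-!
# BSD rank-≤1 residual cell, class X9: `BSD(E,5)` by a SECOND method for `5S4` pairs — ONE full `5`-descent certificate line each, class group by the ARTIN-SPLIT ANALYTIC CERTIFICATE (part A)

HONEST FRAMING (cell `b2b-bsdres-*`, verbatim): the cell deletes COMBINATION-SHAPED residual classes of
the rank-≤1 BSD formula from PUBLISHED theorems only and TYPES the construction-shaped remainder; this
is not "finishing BSD". Class X9 stays TYPED at class level; everything here is PER PAIR; no lane
verdict is changed; no named fact; nothing is booked by this unit (the lane books, the referee rules).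

Unit `b2b-bsdres-x9`, gen 35 (prover-b2b-bsdres-x9-g35-0); docstring refresh gen 36 (prover-b2b-bsdres-x9-g36-0). Companion of `X9/S4DescentPairsZimmertA…E.lean` (gen 14; 37 pairs,
class group Zimmert-certified) with the SAME theorem shape; THIS FILE (part A) = 11 of the 22 pairs of `HOME/b2b-bsdres-x9/
FINISH.md` §2 whose gen-14 full `5`-descent line (x11c engine `s4desc` over the degree-24 field `R = ℚ(E[5]∖0)`, run + independent
verifier, `dim_𝔽₅ Sel^(5)(E/ℚ) = r_an` exactly) was «closed under GRH, open unconditionally» because the Zimmert bound of `R`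
(`2.6·10¹⁰ … 8.4·10¹⁸`: ≈ 900 core-h of prime-ideal enumeration for the smallest, out of reach for the rest) was never run: `38642e1`, `44652e1`, `44652f1`, `46128l1`, `106032bo1`, `106032bq1`, `110976o1`, `110976v1`, `155682e1`, `184512e1`, `203136s1`.
What replaces Zimmert (X9-CENSUS-G32 §2, referee rulings R194.9 / R195.6 / R199.6 / R204, engines RULINGS R-461(a)): per pair the ONE
number the descent line needs from the class group is delivered by the identity `x := A/R~ = h_R/k` (`A = h_R·R_R` from the residue of
`ζ_R`, `R~` the regulator of PARI's 13 GRH units — genuine units, maximal order PROVEN by `nfcertify` — and `k = [U_R : μU~] ≤ R~/0.2052`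
by Friedman's absolute regulator bound): (C1) a CERTIFIED ball for `A` with `∣x − h~∣·R~/0.2052 < ½` forces `h_R = k·h~`; (C2) the
residues of the units at 40 degree-one primes have full `𝔽₅`-rank ⇒ `5 ∤ k` ⇒ `v₅(h_R) = v₅(h~)`; (C3) `5 ∤ h~` ⇒ `Cl_S(R)[5] = 0`, or
(`5 ∥ h~`, five pairs) an exhibited `S`-supported class of order exactly 5 ⇒ `Cl_S(R)[5] = 0`; with the exact 5-saturation of the found
`S`-units, `K(S,5)` is exactly the space the gen-14 descent used — so the line no longer rests on GRH but on that certificate.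
`A` is certified by the cell's ROUTE-2 INSTRUMENT (x9 gens 32–35; design `HOME/b2b-bsdres-x9/g34/ROUTE2-DESIGN.md` v2.1): the
Artin factorisation `ζ_R = ζ_{L0}·L(ρ₀)·L(ρ₀⊗σ₂)·L(ψ²)·conj` over the sextic line field `L0` (`5S4 = N(Q₈)`; the character identities
`Ind ψ ≅ ρ₀ ⊕ Ind λ`, `Ind ψ² ≅ τ₁ ⊕ τ₂`, the explicit Brauer lift `ρ₀ : G → GL₂(ℤ[i])`, its reduction to `ρ̄` and its Frobenius-trace
table are KERNEL THEOREMS: `X9/ArtinSplit5S4Certificate.lean` p373922, `X9/ArtinSplit5S4Reduction.lean` p375402), every factor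
evaluated at `s = 1` in Arb ball arithmetic with the contour-shift remainders and the Nicolas–Robin tails INSIDE the radius (pinned bundle
`code/b2b-bsdres-x9/g34/job1`, SHA256SUMS `e8d67147…`, ONE environment for all 22 rows, kit j207797–j207804; `g34/ROWS.md`), the exact
pieces (`Res ζ_{L0}` with `bnfcertify(L0) = 1`, regulators of certified units, `L(1,ψ²) = Res ζ_{K₂}/Res ζ_{L0}` where `bnfcertify(K₂) = 1`
— 6 of the pairs here in-record, 1 more since their long-`bnfcertify` k2cert landing — else `∣L(1,τ₁)∣²`, whose additive Euler factors, FE-sieved in the GEN 34 records, are EXACT since x9 GEN 36: `τ₁ ≅ (ζ_{L0}/ζ_{F₃}) ⊗ ε` on `5S4`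
(kernel `X9/ArtinSplit5S4Tau1Twist.lean`; per-row check kit j238441, `HOME/b2b-bsdres-x9/g36/TAU1-EXACT.md`: the sieve's choice WAS the exact factor in
all 22 rows, so no ball changes) in 512-bit Arb. Reviews and
reproduction: engines eng-cap-2 READ #1 (D1 / D2 fixed and re-issued) and READ #2 (D- none; REQUESTS L3364 / L3734 / L3747); every GEN 34
record 0 DIFF against its GEN 33 record; the R-461(a)(3)(iii) NON-AUTHOR RE-RUN (cc-eng-5 GEN 83, kit j213064 / j219359 / j219643 on
424128cl1 / 44652f1 / 155682e1 incl. the largest conductor 2.5·10¹²) REPRODUCES the records ball-for-ball (`g34/ROWS.md` § RE-RUN);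
ROUTE 1 (PARI `lfun`, «never certified») agrees with every `L`-value of every row to its working precision (`g34/ENGINE-STATUS.md`: 22 / 22).
What stays ON PAPER / outside the kernel, stated once: characters determine representations and Frobenius' formula (Serre §2.3, §7.2),
Artin formalism and class field theory (the Hecke `L`-functions), analytic continuation (Hecke; Langlands–Tunnell for the octahedral `ρ₀`),
the identification `Gal(ℚ(E[5])/ℚ) ≅ 5S4` per curve (image type + the records' factorisation-pattern check), Friedman's bound
`R_R ≥ 0.2052` (Invent. Math. 98 (1989)), the numerics being Arb's (certified ball arithmetic, a program, reviewed twice and reproduced), and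
PARI's exact layer being ONE implementation (as in the Zimmert files). Nothing here is a Literature fact; the TIER of these lines
(how a certificate of this kind is booked against a Zimmert enumeration) is the referees' word at landing — R204: «tier per row at
re-landing»; the cell lead (lit GEN 124, HOME INBOX l.18036): «the only act that can create an X9R2 tier event is a FILING of kernel
records for the reproduced rows — the X9 owner's call». This is that filing; it books nothing by itself. TIER WORDS given at the
landing (referee A R224.5, REFEREE 2 §158B concurring): rows whose `ψ²` piece is EXACT = «class group CERTIFIED, GRH-free (Artin-split analytic
certificate)» (the Zimmert tier); rows whose `ψ²` piece is FE-sieved = «GRH-free, ANALYTIC-CERTIFICATE (FE-sieved ψ²)», one rung below, the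
upgrade being mechanical per row at its `bnfcertify(K₂) = 1` landing «or of an exact-field ψ² value» — binder-status wording only; each row's
docstring says which it has. GEN 36 (this refresh): the FE sieve is retired for all rows (exact `τ₁` factors, above); the word on the ten
`τ₁` rows after that is referee A's and is carried by `HOME/CLASS-OWNERS.md` row X9, not by this file.
What enters the kernel per pair is ONE line: `hSel : #Sel^(5)(E/ℚ) = 5 ^ r_an` of the tree's class-free
consumer `Typed.bsdp_of_card_selmerGroup_eq_pow_analyticRank` through x11c's
`X11b.bsdp_of_ainvs_of_card_selmerGroup` (GZK `hGZK`, `r_an ≤ 1`, `5 ∤ #Ш_an` ⟹ Miller's `BSDp`; `Δ ≠ 0`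
decided in the kernel). Non-kernel inputs displayed as binders: `hGZK` (published), `r_an ≤ 1` and `#Ш_an`
(Cremona / the cell's engines), `hSel` (the certificate line, status stated per pair).

References: E. F. Schaefer, M. Stoll, Trans. AMS 356 (2004) §2–3; E. Friedman, Invent. Math. 98 (1989) 599–622 (absolute regulator
bound); J.-L. Nicolas, G. Robin, Canad. Math. Bull. 26 (1983) 485–492; J.-P. Serre, *Linear representations of finite groups* §2.3, §7.2;
J. H. Silverman, *AEC* (2009) X.1, X.4 [SilvermanAEC2009]; R. L. Miller, LMS JCM 14 (2011) §1 [Miller2011LMS]; Cremona's tables [Cremona2006].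
-/

set_option autoImplicit false

noncomputable section

open scoped Classical

open WeierstrassCurve Literature.NumberTheory.EllipticCurves
  Literature.NumberTheory.EllipticCurves.Rank1Residual
  Literature.NumberTheory.EllipticCurves.Rank1Residual.Typed
  Summit.BirchSwinnertonDyer.Rank1Residual.X11b

namespace Summit.BirchSwinnertonDyer.Rank1Residual.X9

/-- **`BSD(E,5)` for `38642e1`** (`N = 38642 = 2·139²`, good ordinary at `5`, class X9; Cremona model `[1, -1, 1, -9, 41]`; `ρ̄_{E,5}` of
EXCEPTIONAL type `5S4`; rank `1`, `#Ш_an = 1`; c₂ = 5 (I5), c₁₃₉ = 1 (II)). Heegner-index route of record: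
JETCHEV–CHA (`D = -39`, `m = 20`, `ord₅ m = 1` = `ord₅` of exactly one Tamagawa number; flag `Miller11-Thm54-Cha-case`) — FLAG-FREE here. Here a SECOND, INDEPENDENT method for the same pair: GZK and the certificate line
`#Sel^(5)(E/ℚ) = 5 ^ r_an` — full `5`-descent over `R = ℚ(E[5]∖0)` (degree `24`; x11c gen-13 engine `s4desc`, byte copies;
run of record + independent verifier by unit `b2b-bsdres-x9` gen 14, kit j117662; certificate
`HOME/b2b-bsdres-x9/g14/desc5s4/j117662/certs/cert_38642e1.txt.gz`): `S = [2, 5, 139]`, `#gens R(S,5) = 27`, `5`-saturation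
`[1, 69, 27]`, `dim K_S(R) = 1`, all local images complete, Galois action proved by characters,
**`dim_𝔽₅ Sel^(5)(E/ℚ) = 1`** with the Kummer image of the generator `[[3,4]]` its non-zero element (exact 5th root exhibited / in Fake / non-zero); verifier: VERIFIED; class group used: `Cl(R) = [3, [3]]`, `Cl_S(R) = [1, []]`
from `bnfinit` UNDER GRH (Zimmert bound `1.43e15` out of reach) — made GRH-FREE by the **ARTIN-SPLIT ANALYTIC CERTIFICATE** (X9-CENSUS-G32 §2):
(C1) `A = h_R·R_R = 2889546239663489017.130952… ± 2.03e-19` certified (route 2: Arb, kit j207801, pinned bundle `e8d67147…`, ONE env; `ζ_R = ζ_{L0}·L(ψ)L(ψ²)L(ψ³)`,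
`Ind ψ ≅ ρ₀ ⊕ Ind λ` — kernel group layer `X9/ArtinSplit5S4Certificate` + `…Reduction`; `ψ²` piece EXACT since the k2cert landing: `bnfcertify(K₂) = 1` after 22.8 h (kit j207820, `h(K₂) = 3 [3]`, same `T12` as the record), `L(1,ψ²) = Res ζ_{K₂}/Res ζ_{L0}` INSIDE the record's `∣L(1,τ₁)∣²` ball (`g34/ENGINE-STATUS.md`) — in-record the FE-sieved `τ₁` carried it (K₂ had not certified within 1 200 s); referee A R224.5 (c)(ii): upgrade to «class group CERTIFIED, GRH-free» mechanical at this landing), `R~ = 9.63e17` (13 GRH units, maximal order proven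
`nfcertify = []`, kit j191170), `x = A/R~ = 3.000000… (ball radius 1.48e-37) vs h~ = 3`, `∣x − h~∣·R~/0.2052 ≤ 6.9e-19 < ½` ⇒ `h_R = k·h~`, `k = [U_R : μU~] ≤ 4.69e18` (Friedman);
(C2) residues of `⟨−1, u₁…u₁₃⟩` at 40 degree-one primes have `𝔽₅`-rank 13 / 14 (kit j191170) ⇒ `μU~` 5-saturated; hence `5 ∤ k`, so `5 ∤ h_R` (`h~ = 3`) and `Cl(R)[5] = Cl_S(R)[5] = 0`; (C3) the found `S`-units are 5-saturated in `R^×` (residues at 80 degree-one primes: `𝔽₅`-rank 27 / 28 columns, kit j193062) ⇒ `K(S,5)` IS the gen-14 space.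
Evidence chain: eng-cap-2 READ #1 / #2 (D- none), 0 DIFF vs the GEN 33 record; the pinned bytes + env are those REPRODUCED ball-for-ball by the non-author re-run on the three press rows (cc-eng-5 j213064 / j219359 / j219643); route 1 (PARI `lfun`, «never certified») agrees on every piece — ρ₀: in-record 96 b: ∣Δ∣ 2.15e-28 (r2 rad 3.91e-43) ✓, feq -101; ρ₀⊗σ₂: in-record 96 b (lfundiv): ∣Δ∣ 4.50e-29 (r2 rad 3.45e-38) ✓, feq -115, w -I = ε; ψ²: exact (k2cert j207820: bnfcertify = 1, h = 3 [3]): Res ζ_K₂/Res ζ_L0 vs ∣L(1,τ₁)∣²: ∣Δ∣ 2.52e-41 ✓; route 1 (r1psi2 j208511 64 b feq -52): ∣Δ∣ 7.13e-18 ✓.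
On paper: characters ↔ representations, Artin formalism / class field theory, `Gal(ℚ(E[5])/ℚ) ≅ 5S4` per curve (image type + factor-pattern check);
PARI's exact layer (fields, `bnr`, `bnfcertify(L0) = 1`) is ONE implementation. This certificate line is UNCONDITIONAL GIVEN that certificate — its TIER is the referees' (R194.9 / R204; lit l.18036).
Binders: `hGZK`, `r_an ≤ 1`, `#Ш_an` a `5`-adic unit, `hSel`. Kernel: `Δ ≠ 0`.
[cite: Miller2011LMS, §1 and Def. 1.1] [cite: Cremona2006, Table 1 (Cremona label 38642e1)] -/
theorem bsdp_s38642e1 (hGZK : rank_eq_analyticRank_of_analyticRank_le_one)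
    (W : WeierstrassCurve ℚ) (hW : W = ⟨1, -1, 1, -9, 41⟩)
    (hr : W.analyticRank ≤ 1) {q : ℚ} (hq : shaAn W = (q : ℂ)) (hv : padicValRat 5 q = 0)
    (hSel : Nat.card (W.selmerGroup (5 : ℤ)) = 5 ^ W.analyticRank) : BSDp W 5 := by
  subst hW
  haveI : Fact (Nat.Prime 5) := ⟨by norm_num⟩
  exact bsdp_of_ainvs_of_card_selmerGroup hGZK 1 (-1) 1 (-9) 41 (by decide +kernel) 5
    hr hq hv hSel

/-- **`BSD(E,5)` for `44652e1`** (`N = 44652 = 2²·3·61²`, good ordinary at `5`, class X9; Cremona model `[0, 1, 0, -1850, -31119]`; `ρ̄_{E,5}` of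
EXCEPTIONAL type `5S4`; rank `1`, `#Ш_an = 1`; c₂ = 3 (IV), c₃ = 10 (I10), c₆₁ = 1 (II)). Heegner-index route of record:
JETCHEV–CHA (`D = -47`, `m = 60`, `ord₅ m = 1` = `ord₅` of exactly one Tamagawa number; flag `Miller11-Thm54-Cha-case`) — FLAG-FREE here. Here a SECOND, INDEPENDENT method for the same pair: GZK and the certificate line
`#Sel^(5)(E/ℚ) = 5 ^ r_an` — full `5`-descent over `R = ℚ(E[5]∖0)` (degree `24`; x11c gen-13 engine `s4desc`, byte copies;
run of record + independent verifier by unit `b2b-bsdres-x9` gen 14, kit j117662; certificate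
`HOME/b2b-bsdres-x9/g14/desc5s4/j117662/certs/cert_44652e1.txt.gz`): `S = [2, 3, 5, 61]`, `#gens R(S,5) = 36`, `5`-saturation
`[1, 96, 36]`, `dim K_S(R) = 0`, all local images complete, Galois action proved by characters,
**`dim_𝔽₅ Sel^(5)(E/ℚ) = 1`** with the Kummer image of the generator `[[-26,9]]` its non-zero element (exact 5th root exhibited / in Fake / non-zero); verifier: VERIFIED; class group used: `Cl(R) = [18, [6, 3]]`, `Cl_S(R) = [2, [2]]`
from `bnfinit` UNDER GRH (Zimmert bound `9.71e13` out of reach) — made GRH-FREE by the **ARTIN-SPLIT ANALYTIC CERTIFICATE** (X9-CENSUS-G32 §2):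
(C1) `A = h_R·R_R = 370918871212613239.855357… ± 3.83e-22` certified (route 2: Arb, kit j207802, pinned bundle `e8d67147…`, ONE env; `ζ_R = ζ_{L0}·L(ψ)L(ψ²)L(ψ³)`,
`Ind ψ ≅ ρ₀ ⊕ Ind λ` — kernel group layer `X9/ArtinSplit5S4Certificate` + `…Reduction`; `ψ²` piece EXACT: `bnfcertify(K₂) = 1` in-record, three-way agreement with `∣L(1,τ₁)∣²` and PARI), `R~ = 2.06e16` (13 GRH units, maximal order proven
`nfcertify = []`, kit j191166), `x = A/R~ = 18.000000… (ball radius 1.21e-38) vs h~ = 18`, `∣x − h~∣·R~/0.2052 ≤ 1.2e-21 < ½` ⇒ `h_R = k·h~`, `k = [U_R : μU~] ≤ 1e17` (Friedman);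
(C2) residues of `⟨−1, u₁…u₁₃⟩` at 40 degree-one primes have `𝔽₅`-rank 13 / 14 (kit j191166) ⇒ `μU~` 5-saturated; hence `5 ∤ k`, so `5 ∤ h_R` (`h~ = 18`) and `Cl(R)[5] = Cl_S(R)[5] = 0`; (C3) the found `S`-units are 5-saturated in `R^×` (residues at 80 degree-one primes: `𝔽₅`-rank 36 / 37 columns, kit j193062) ⇒ `K(S,5)` IS the gen-14 space.
Evidence chain: eng-cap-2 READ #1 / #2 (D- none), 0 DIFF vs the GEN 33 record; the pinned bytes + env are those REPRODUCED ball-for-ball by the non-author re-run on the three press rows (cc-eng-5 j213064 / j219359 / j219643); route 1 (PARI `lfun`, «never certified») agrees on every piece — ρ₀: in-record 96 b: ∣Δ∣ 4.52e-28 (r2 rad 6.56e-41) ✓, feq -108; ρ₀⊗σ₂: in-record 96 b (lfundiv): ∣Δ∣ 4.73e-28 (r2 rad 5.23e-40) ✓, feq -115, w -I = ε; ψ²: exact (K₂ cert in-record): ∣Δ∣ 4.91e-38 ✓; route 1 (in-record 64 b): ∣Δ∣ 4.63e-18 ✓.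
On paper: characters ↔ representations, Artin formalism / class field theory, `Gal(ℚ(E[5])/ℚ) ≅ 5S4` per curve (image type + factor-pattern check);
PARI's exact layer (fields, `bnr`, `bnfcertify(L0) = 1`) is ONE implementation. This certificate line is UNCONDITIONAL GIVEN that certificate — its TIER is the referees' (R194.9 / R204; lit l.18036).
Binders: `hGZK`, `r_an ≤ 1`, `#Ш_an` a `5`-adic unit, `hSel`. Kernel: `Δ ≠ 0`.
[cite: Miller2011LMS, §1 and Def. 1.1] [cite: Cremona2006, Table 1 (Cremona label 44652e1)] -/
theorem bsdp_s44652e1 (hGZK : rank_eq_analyticRank_of_analyticRank_le_one)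
    (W : WeierstrassCurve ℚ) (hW : W = ⟨0, 1, 0, -1850, -31119⟩)
    (hr : W.analyticRank ≤ 1) {q : ℚ} (hq : shaAn W = (q : ℂ)) (hv : padicValRat 5 q = 0)
    (hSel : Nat.card (W.selmerGroup (5 : ℤ)) = 5 ^ W.analyticRank) : BSDp W 5 := by
  subst hW
  haveI : Fact (Nat.Prime 5) := ⟨by norm_num⟩
  exact bsdp_of_ainvs_of_card_selmerGroup hGZK 0 1 0 (-1850) (-31119) (by decide +kernel) 5
    hr hq hv hSel

/-- **`BSD(E,5)` for `44652f1`** (`N = 44652 = 2²·3·61²`, good ordinary at `5`, class X9; Cremona model `[0, 1, 0, -6885090, -6925728339]`; `ρ̄_{E,5}` of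
EXCEPTIONAL type `5S4`; rank `1`, `#Ш_an = 1`; c₂ = 1 (IV), c₃ = 10 (I10), c₆₁ = 3 (IV*)). Heegner-index route of record:
JETCHEV–CHA (`D = -47`, `m = 60`, `ord₅ m = 1` = `ord₅` of exactly one Tamagawa number; flag `Miller11-Thm54-Cha-case`) — FLAG-FREE here. Here a SECOND, INDEPENDENT method for the same pair: GZK and the certificate line
`#Sel^(5)(E/ℚ) = 5 ^ r_an` — full `5`-descent over `R = ℚ(E[5]∖0)` (degree `24`; x11c gen-13 engine `s4desc`, byte copies;
run of record + independent verifier by unit `b2b-bsdres-x9` gen 14, kit j117663; certificate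
`HOME/b2b-bsdres-x9/g14/desc5s4/j117663/certs/cert_44652f1.txt.gz`): `S = [2, 3, 5, 61]`, `#gens R(S,5) = 40`, `5`-saturation
`[1, 132, 40]`, `dim K_S(R) = 0`, all local images complete, Galois action proved by characters,
**`dim_𝔽₅ Sel^(5)(E/ℚ) = 1`** with the Kummer image of the generator `[[-39699/25,301401/125]]` its non-zero element (exact 5th root exhibited / in Fake / non-zero); verifier: VERIFIED; class group used: `Cl(R) = [9, [3, 3]]`, `Cl_S(R) = [1, []]`
from `bnfinit` UNDER GRH (Zimmert bound `2.61e10` out of reach) — made GRH-FREE by the **ARTIN-SPLIT ANALYTIC CERTIFICATE** (X9-CENSUS-G32 §2):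
(C1) `A = h_R·R_R = 82829738080080.636327… ± 5.14e-24` certified (route 2: Arb, kit j207797, pinned bundle `e8d67147…`, ONE env; `ζ_R = ζ_{L0}·L(ψ)L(ψ²)L(ψ³)`,
`Ind ψ ≅ ρ₀ ⊕ Ind λ` — kernel group layer `X9/ArtinSplit5S4Certificate` + `…Reduction`; `ψ²` piece EXACT: `bnfcertify(K₂) = 1` in-record, three-way agreement with `∣L(1,τ₁)∣²` and PARI), `R~ = 9.2e12` (13 GRH units, maximal order proven
`nfcertify = []`, kit j191159), `x = A/R~ = 9.000000… (ball radius 3.03e-37) vs h~ = 9`, `∣x − h~∣·R~/0.2052 ≤ 1.4e-23 < ½` ⇒ `h_R = k·h~`, `k = [U_R : μU~] ≤ 4.49e13` (Friedman);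
(C2) residues of `⟨−1, u₁…u₁₃⟩` at 40 degree-one primes have `𝔽₅`-rank 13 / 14 (kit j191159) ⇒ `μU~` 5-saturated; hence `5 ∤ k`, so `5 ∤ h_R` (`h~ = 9`) and `Cl(R)[5] = Cl_S(R)[5] = 0`; (C3) the found `S`-units are 5-saturated in `R^×` (residues at 80 degree-one primes: `𝔽₅`-rank 40 / 41 columns, kit j193062) ⇒ `K(S,5)` IS the gen-14 space.
Evidence chain: eng-cap-2 READ #1 / #2 (D- none), 0 DIFF vs the GEN 33 record; NON-AUTHOR RE-RUN cc-eng-5 kit j219359 from a clean copy of the pin REPRODUCES this record ball-for-ball (every certified ball and exact field SAME); route 1 (PARI `lfun`, «never certified») agrees on every piece — ρ₀: in-record 96 b: ∣Δ∣ 1.37e-28 (r2 rad 6.88e-41) ✓, feq -107; ρ₀⊗σ₂: in-record 96 b (lfundiv): ∣Δ∣ 2.43e-28 (r2 rad 5.53e-38) ✓, feq -111, w -I = ε; ψ²: exact (K₂ cert in-record): ∣Δ∣ 4.91e-38 ✓; route 1 (r1psi2 j208510 64 b feq -56): ∣Δ∣ 4.63e-18 ✓.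
On paper: characters ↔ representations, Artin formalism / class field theory, `Gal(ℚ(E[5])/ℚ) ≅ 5S4` per curve (image type + factor-pattern check);
PARI's exact layer (fields, `bnr`, `bnfcertify(L0) = 1`) is ONE implementation. This certificate line is UNCONDITIONAL GIVEN that certificate — its TIER is the referees' (R194.9 / R204; lit l.18036).
Binders: `hGZK`, `r_an ≤ 1`, `#Ш_an` a `5`-adic unit, `hSel`. Kernel: `Δ ≠ 0`.
[cite: Miller2011LMS, §1 and Def. 1.1] [cite: Cremona2006, Table 1 (Cremona label 44652f1)] -/
theorem bsdp_s44652f1 (hGZK : rank_eq_analyticRank_of_analyticRank_le_one)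
    (W : WeierstrassCurve ℚ) (hW : W = ⟨0, 1, 0, -6885090, -6925728339⟩)
    (hr : W.analyticRank ≤ 1) {q : ℚ} (hq : shaAn W = (q : ℂ)) (hv : padicValRat 5 q = 0)
    (hSel : Nat.card (W.selmerGroup (5 : ℤ)) = 5 ^ W.analyticRank) : BSDp W 5 := by
  subst hW
  haveI : Fact (Nat.Prime 5) := ⟨by norm_num⟩
  exact bsdp_of_ainvs_of_card_selmerGroup hGZK 0 1 0 (-6885090) (-6925728339) (by decide +kernel) 5
    hr hq hv hSel

/-- **`BSD(E,5)` for `46128l1`** (`N = 46128 = 2⁴·3·31²`, good ordinary at `5`, class X9; Cremona model `[0, 1, 0, 703, -89877]`; `ρ̄_{E,5}` of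
EXCEPTIONAL type `5S4`; rank `1`, `#Ш_an = 1`; c₂ = 1 (I0*), c₃ = 15 (I15), c₃₁ = 1 (II)). Heegner-index route of record:
JETCHEV–CHA (`D = -119`, `m = 60`, `ord₅ m = 1` = `ord₅` of exactly one Tamagawa number; flag `Miller11-Thm54-Cha-case`) — FLAG-FREE here. Here a SECOND, INDEPENDENT method for the same pair: GZK and the certificate line
`#Sel^(5)(E/ℚ) = 5 ^ r_an` — full `5`-descent over `R = ℚ(E[5]∖0)` (degree `24`; x11c gen-13 engine `s4desc`, byte copies;
run of record + independent verifier by unit `b2b-bsdres-x9` gen 14, kit j117662; certificate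
`HOME/b2b-bsdres-x9/g14/desc5s4/j117662/certs/cert_46128l1.txt.gz`): `S = [2, 3, 5, 31]`, `#gens R(S,5) = 30`, `5`-saturation
`[1, 156, 30]`, `dim K_S(R) = 0`, all local images complete, Galois action proved by characters,
**`dim_𝔽₅ Sel^(5)(E/ℚ) = 1`** with the Kummer image of the generator `[[142,1701]]` its non-zero element (exact 5th root exhibited / in Fake / non-zero); verifier: VERIFIED; class group used: `Cl(R) = [180, [30, 6]]`, `Cl_S(R) = [1, []]`
from `bnfinit` UNDER GRH (Zimmert bound `2.28e14` out of reach) — made GRH-FREE by the **ARTIN-SPLIT ANALYTIC CERTIFICATE** (X9-CENSUS-G32 §2):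
(C1) `A = h_R·R_R = 326477162510103802.580727… ± 6.57e-21` certified (route 2: Arb, kit j207802, pinned bundle `e8d67147…`, ONE env; `ζ_R = ζ_{L0}·L(ψ)L(ψ²)L(ψ³)`,
`Ind ψ ≅ ρ₀ ⊕ Ind λ` — kernel group layer `X9/ArtinSplit5S4Certificate` + `…Reduction`; `ψ²` piece EXACT: `bnfcertify(K₂) = 1` in-record, three-way agreement with `∣L(1,τ₁)∣²` and PARI), `R~ = 1.81e15` (13 GRH units, maximal order proven
`nfcertify = []`, kit j191173), `x = A/R~ = 180.000000… (ball radius 2.99e-36) vs h~ = 180`, `∣x − h~∣·R~/0.2052 ≤ 2.6e-20 < ½` ⇒ `h_R = k·h~`, `k = [U_R : μU~] ≤ 8.84e15` (Friedman);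
(C2) residues of `⟨−1, u₁…u₁₃⟩` at 40 degree-one primes have `𝔽₅`-rank 13 / 14 (kit j191173) ⇒ `μU~` 5-saturated; hence `5 ∤ k`, so `v₅(h_R) = v₅(h~) = 1` (`h~ = 180`); (C3) kit j193062: `A := g₁^6` has `A⁵ = (α)` (exact), residue rank of `⟨−1, uᵢ, α⟩` = 14 ⇒ `[A]` has order exactly 5, and `A·∏𝔭ᵢ^(−eᵢ) = (β)` (exact, `e = [24, 6, 0, 0, 0, 24, 0, 0, 0, 0, 0, 0, 0, 0, 0, 0, 0]` on the `S`-primes) ⇒ `Cl(R)[5^∞] = ⟨[A]⟩ ⊂ ⟨S-primes⟩` ⇒ `Cl_S(R)[5] = 0`; the found `S`-units are 5-saturated (rank 30 / 31) ⇒ `K(S,5)` IS the gen-14 space.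
Evidence chain: eng-cap-2 READ #1 / #2 (D- none), 0 DIFF vs the GEN 33 record; the pinned bytes + env are those REPRODUCED ball-for-ball by the non-author re-run on the three press rows (cc-eng-5 j213064 / j219359 / j219643); route 1 (PARI `lfun`, «never certified») agrees on every piece — ρ₀: in-record 96 b: ∣Δ∣ 9.13e-29 (r2 rad 4.18e-40) ✓, feq -108; ρ₀⊗σ₂: in-record 96 b (lfundiv): ∣Δ∣ 3.52e-29 (r2 rad 8.50e-39) ✓, feq -111, w -I = ε; ψ²: exact (K₂ cert in-record): ∣Δ∣ 4.78e-37 ✓; route 1 (in-record 64 b): ∣Δ∣ 4.18e-18 ✓.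
On paper: characters ↔ representations, Artin formalism / class field theory, `Gal(ℚ(E[5])/ℚ) ≅ 5S4` per curve (image type + factor-pattern check);
PARI's exact layer (fields, `bnr`, `bnfcertify(L0) = 1`) is ONE implementation. This certificate line is UNCONDITIONAL GIVEN that certificate — its TIER is the referees' (R194.9 / R204; lit l.18036).
Binders: `hGZK`, `r_an ≤ 1`, `#Ш_an` a `5`-adic unit, `hSel`. Kernel: `Δ ≠ 0`.
[cite: Miller2011LMS, §1 and Def. 1.1] [cite: Cremona2006, Table 1 (Cremona label 46128l1)] -/
theorem bsdp_s46128l1 (hGZK : rank_eq_analyticRank_of_analyticRank_le_one)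
    (W : WeierstrassCurve ℚ) (hW : W = ⟨0, 1, 0, 703, -89877⟩)
    (hr : W.analyticRank ≤ 1) {q : ℚ} (hq : shaAn W = (q : ℂ)) (hv : padicValRat 5 q = 0)
    (hSel : Nat.card (W.selmerGroup (5 : ℤ)) = 5 ^ W.analyticRank) : BSDp W 5 := by
  subst hW
  haveI : Fact (Nat.Prime 5) := ⟨by norm_num⟩
  exact bsdp_of_ainvs_of_card_selmerGroup hGZK 0 1 0 703 (-89877) (by decide +kernel) 5
    hr hq hv hSel

/-- **`BSD(E,5)` for `106032bo1`** (`N = 106032 = 2⁴·3·47²`, good ordinary at `5`, class X9; Cremona model `[0, 1, 0, -501, 4707]`; `ρ̄_{E,5}` of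
EXCEPTIONAL type `5S4`; rank `0`, `#Ш_an = 1`; c₂ = 1 (II*), c₃ = 5 (I5), c₄₇ = 1 (II)). Heegner-index route of record:
JETCHEV–CHA (`D = -23`, `m = 10`, `ord₅ m = 1` = `ord₅` of exactly one Tamagawa number; flag `Miller11-Thm54-Cha-case`) — FLAG-FREE here. Here a SECOND, INDEPENDENT method for the same pair: GZK and the certificate line
`#Sel^(5)(E/ℚ) = 5 ^ r_an` — full `5`-descent over `R = ℚ(E[5]∖0)` (degree `24`; x11c gen-13 engine `s4desc`, byte copies;
run of record + independent verifier by unit `b2b-bsdres-x9` gen 14, kit j117661; certificate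
`HOME/b2b-bsdres-x9/g14/desc5s4/j117661/certs/cert_106032bo1.txt.gz`): `S = [2, 3, 5, 47]`, `#gens R(S,5) = 31`, `5`-saturation
`[1, 86, 31]`, `dim K_S(R) = 0`, all local images complete, Galois action proved by characters,
**`dim_𝔽₅ Sel^(5)(E/ℚ) = 0`**; verifier: VERIFIED; class group used: `Cl(R) = [4, [2, 2]]`, `Cl_S(R) = [1, []]`
from `bnfinit` UNDER GRH (Zimmert bound `1.15e14` out of reach) — made GRH-FREE by the **ARTIN-SPLIT ANALYTIC CERTIFICATE** (X9-CENSUS-G32 §2):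
(C1) `A = h_R·R_R = 58965111570177320.993952… ± 6.31e-22` certified (route 2: Arb, kit j207800, pinned bundle `e8d67147…`, ONE env; `ζ_R = ζ_{L0}·L(ψ)L(ψ²)L(ψ³)`,
`Ind ψ ≅ ρ₀ ⊕ Ind λ` — kernel group layer `X9/ArtinSplit5S4Certificate` + `…Reduction`; `ψ²` piece EXACT: `bnfcertify(K₂) = 1` in-record, three-way agreement with `∣L(1,τ₁)∣²` and PARI), `R~ = 1.47e16` (13 GRH units, maximal order proven
`nfcertify = []`, kit j191173), `x = A/R~ = 4.000000… (ball radius 9.35e-39) vs h~ = 4`, `∣x − h~∣·R~/0.2052 ≤ 6.7e-22 < ½` ⇒ `h_R = k·h~`, `k = [U_R : μU~] ≤ 7.18e16` (Friedman);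
(C2) residues of `⟨−1, u₁…u₁₃⟩` at 40 degree-one primes have `𝔽₅`-rank 13 / 14 (kit j191173) ⇒ `μU~` 5-saturated; hence `5 ∤ k`, so `5 ∤ h_R` (`h~ = 4`) and `Cl(R)[5] = Cl_S(R)[5] = 0`; (C3) the found `S`-units are 5-saturated in `R^×` (residues at 80 degree-one primes: `𝔽₅`-rank 31 / 32 columns, kit j193062) ⇒ `K(S,5)` IS the gen-14 space.
Evidence chain: eng-cap-2 READ #1 / #2 (D- none), 0 DIFF vs the GEN 33 record; the pinned bytes + env are those REPRODUCED ball-for-ball by the non-author re-run on the three press rows (cc-eng-5 j213064 / j219359 / j219643); route 1 (PARI `lfun`, «never certified») agrees on every piece — ρ₀: in-record 96 b: ∣Δ∣ 3.03e-29 (r2 rad 7.98e-42) ✓, feq -107; ρ₀⊗σ₂: in-record 96 b (lfundiv): ∣Δ∣ 4.93e-29 (r2 rad 2.30e-39) ✓, feq ERR, w 1 = ε; ψ²: exact (K₂ cert in-record): ∣Δ∣ 1.43e-40 ✓; route 1 (in-record 64 b): ∣Δ∣ 4.43e-18 ✓.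
On paper: characters ↔ representations, Artin formalism / class field theory, `Gal(ℚ(E[5])/ℚ) ≅ 5S4` per curve (image type + factor-pattern check);
PARI's exact layer (fields, `bnr`, `bnfcertify(L0) = 1`) is ONE implementation. This certificate line is UNCONDITIONAL GIVEN that certificate — its TIER is the referees' (R194.9 / R204; lit l.18036).
Binders: `hGZK`, `r_an ≤ 1`, `#Ш_an` a `5`-adic unit, `hSel`. Kernel: `Δ ≠ 0`.
[cite: Miller2011LMS, §1 and Def. 1.1] [cite: Cremona2006, Table 1 (Cremona label 106032bo1)] -/
theorem bsdp_s106032bo1 (hGZK : rank_eq_analyticRank_of_analyticRank_le_one)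
    (W : WeierstrassCurve ℚ) (hW : W = ⟨0, 1, 0, -501, 4707⟩)
    (hr : W.analyticRank ≤ 1) {q : ℚ} (hq : shaAn W = (q : ℂ)) (hv : padicValRat 5 q = 0)
    (hSel : Nat.card (W.selmerGroup (5 : ℤ)) = 5 ^ W.analyticRank) : BSDp W 5 := by
  subst hW
  haveI : Fact (Nat.Prime 5) := ⟨by norm_num⟩
  exact bsdp_of_ainvs_of_card_selmerGroup hGZK 0 1 0 (-501) 4707 (by decide +kernel) 5
    hr hq hv hSel

/-- **`BSD(E,5)` for `106032bq1`** (`N = 106032 = 2⁴·3·47²`, good ordinary at `5`, class X9; Cremona model `[0, 1, 0, -1107445, -506410141]`; `ρ̄_{E,5}` of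
EXCEPTIONAL type `5S4`; rank `0`, `#Ш_an = 1`; c₂ = 1 (II*), c₃ = 5 (I5), c₄₇ = 1 (IV*)). Heegner-index route of record:
JETCHEV–CHA (`D = -359`, `m = 10`, `ord₅ m = 1` = `ord₅` of exactly one Tamagawa number; flag `Miller11-Thm54-Cha-case`) — FLAG-FREE here. Here a SECOND, INDEPENDENT method for the same pair: GZK and the certificate line
`#Sel^(5)(E/ℚ) = 5 ^ r_an` — full `5`-descent over `R = ℚ(E[5]∖0)` (degree `24`; x11c gen-13 engine `s4desc`, byte copies;
run of record + independent verifier by unit `b2b-bsdres-x9` gen 14, kit j117662; certificate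
`HOME/b2b-bsdres-x9/g14/desc5s4/j117662/certs/cert_106032bq1.txt.gz`): `S = [2, 3, 5, 47]`, `#gens R(S,5) = 35`, `5`-saturation
`[1, 117, 35]`, `dim K_S(R) = 0`, all local images complete, Galois action proved by characters,
**`dim_𝔽₅ Sel^(5)(E/ℚ) = 0`**; verifier: VERIFIED; class group used: `Cl(R) = [10, [10]]`, `Cl_S(R) = [1, []]`
from `bnfinit` UNDER GRH (Zimmert bound `5.18e10` out of reach) — made GRH-FREE by the **ARTIN-SPLIT ANALYTIC CERTIFICATE** (X9-CENSUS-G32 §2):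
(C1) `A = h_R·R_R = 163758948558676.743518… ± 2.40e-22` certified (route 2: Arb, kit j207804, pinned bundle `e8d67147…`, ONE env; `ζ_R = ζ_{L0}·L(ψ)L(ψ²)L(ψ³)`,
`Ind ψ ≅ ρ₀ ⊕ Ind λ` — kernel group layer `X9/ArtinSplit5S4Certificate` + `…Reduction`; `ψ²` piece EXACT: `bnfcertify(K₂) = 1` in-record, three-way agreement with `∣L(1,τ₁)∣²` and PARI), `R~ = 1.64e13` (13 GRH units, maximal order proven
`nfcertify = []`, kit j191159), `x = A/R~ = 10.000000… (ball radius 6.41e-36) vs h~ = 10`, `∣x − h~∣·R~/0.2052 ≤ 5.1e-22 < ½` ⇒ `h_R = k·h~`, `k = [U_R : μU~] ≤ 7.98e13` (Friedman);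
(C2) residues of `⟨−1, u₁…u₁₃⟩` at 40 degree-one primes have `𝔽₅`-rank 13 / 14 (kit j191159) ⇒ `μU~` 5-saturated; hence `5 ∤ k`, so `v₅(h_R) = v₅(h~) = 1` (`h~ = 10`); (C3) kit j193062: `A := g₁^2` has `A⁵ = (α)` (exact), residue rank of `⟨−1, uᵢ, α⟩` = 14 ⇒ `[A]` has order exactly 5, and `A·∏𝔭ᵢ^(−eᵢ) = (β)` (exact, `e = [2, 0, 0, 6, 0, 0, 0, 0, 0, 0, 0, 0, 0, 0, 0, 0, 0, 0, 0, 0, 0, 0]` on the `S`-primes) ⇒ `Cl(R)[5^∞] = ⟨[A]⟩ ⊂ ⟨S-primes⟩` ⇒ `Cl_S(R)[5] = 0`; the found `S`-units are 5-saturated (rank 35 / 36) ⇒ `K(S,5)` IS the gen-14 space.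
Evidence chain: eng-cap-2 READ #1 / #2 (D- none), 0 DIFF vs the GEN 33 record; the pinned bytes + env are those REPRODUCED ball-for-ball by the non-author re-run on the three press rows (cc-eng-5 j213064 / j219359 / j219643); route 1 (PARI `lfun`, «never certified») agrees on every piece — ρ₀: in-record 96 b: ∣Δ∣ 9.27e-29 (r2 rad 8.29e-42) ✓, feq -107; ρ₀⊗σ₂: in-record 96 b (lfundiv): ∣Δ∣ 4.53e-28 (r2 rad 6.45e-37) ✓, feq -113, w -I = ε; ψ²: exact (K₂ cert in-record): ∣Δ∣ 1.43e-40 ✓; route 1 (in-record 64 b): ∣Δ∣ 4.43e-18 ✓.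
On paper: characters ↔ representations, Artin formalism / class field theory, `Gal(ℚ(E[5])/ℚ) ≅ 5S4` per curve (image type + factor-pattern check);
PARI's exact layer (fields, `bnr`, `bnfcertify(L0) = 1`) is ONE implementation. This certificate line is UNCONDITIONAL GIVEN that certificate — its TIER is the referees' (R194.9 / R204; lit l.18036).
Binders: `hGZK`, `r_an ≤ 1`, `#Ш_an` a `5`-adic unit, `hSel`. Kernel: `Δ ≠ 0`.
[cite: Miller2011LMS, §1 and Def. 1.1] [cite: Cremona2006, Table 1 (Cremona label 106032bq1)] -/
theorem bsdp_s106032bq1 (hGZK : rank_eq_analyticRank_of_analyticRank_le_one)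
    (W : WeierstrassCurve ℚ) (hW : W = ⟨0, 1, 0, -1107445, -506410141⟩)
    (hr : W.analyticRank ≤ 1) {q : ℚ} (hq : shaAn W = (q : ℂ)) (hv : padicValRat 5 q = 0)
    (hSel : Nat.card (W.selmerGroup (5 : ℤ)) = 5 ^ W.analyticRank) : BSDp W 5 := by
  subst hW
  haveI : Fact (Nat.Prime 5) := ⟨by norm_num⟩
  exact bsdp_of_ainvs_of_card_selmerGroup hGZK 0 1 0 (-1107445) (-506410141) (by decide +kernel) 5
    hr hq hv hSel

/-- **`BSD(E,5)` for `110976o1`** (`N = 110976 = 2⁷·3·17²`, good ordinary at `5`, class X9; Cremona model `[0, 1, 0, -130, -634]`; `ρ̄_{E,5}` of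
EXCEPTIONAL type `5S4`; rank `0`, `#Ш_an = 1`; c₂ = 1 (II), c₃ = 5 (I5), c₁₇ = 1 (II)). Heegner-index route of record:
JETCHEV–CHA (`D = -47`, `m = 10`, `ord₅ m = 1` = `ord₅` of exactly one Tamagawa number; flag `Miller11-Thm54-Cha-case`) — FLAG-FREE here. Here a SECOND, INDEPENDENT method for the same pair: GZK and the certificate line
`#Sel^(5)(E/ℚ) = 5 ^ r_an` — full `5`-descent over `R = ℚ(E[5]∖0)` (degree `24`; x11c gen-13 engine `s4desc`, byte copies;
run of record + independent verifier by unit `b2b-bsdres-x9` gen 14, kit j117661; certificate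
`HOME/b2b-bsdres-x9/g14/desc5s4/j117661/certs/cert_110976o1.txt.gz`): `S = [2, 3, 5, 17]`, `#gens R(S,5) = 33`, `5`-saturation
`[1, 174, 33]`, `dim K_S(R) = 0`, all local images complete, Galois action proved by characters,
**`dim_𝔽₅ Sel^(5)(E/ℚ) = 0`**; verifier: VERIFIED; class group used: `Cl(R) = [4, [2, 2]]`, `Cl_S(R) = [1, []]`
from `bnfinit` UNDER GRH (Zimmert bound `1.84e16` out of reach) — made GRH-FREE by the **ARTIN-SPLIT ANALYTIC CERTIFICATE** (X9-CENSUS-G32 §2):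
(C1) `A = h_R·R_R = 129275756858202553755.398673… ± 2.67e-18` certified (route 2: Arb, kit j207800, pinned bundle `e8d67147…`, ONE env; `ζ_R = ζ_{L0}·L(ψ)L(ψ²)L(ψ³)`,
`Ind ψ ≅ ρ₀ ⊕ Ind λ` — kernel group layer `X9/ArtinSplit5S4Certificate` + `…Reduction`; `ψ²` piece `∣L(1,τ₁)∣²` with EXACT Euler factors since x9 GEN 36: `τ₁ ≅ (ζ_{L0}/ζ_{F₃}) ⊗ ε` (`F₃` the cubic subfield of `L0`, `ε` the quartic Dirichlet character mod 5 with `ε(2) = i`; kernel identity `X9/ArtinSplit5S4Tau1Twist`, per-row check kit j238441: the exact additive factors EQUAL the in-record FE-sieved choice, split the `bnr` factor of `Ind ψ²`, match the class table at every good `p ≤ 3000` and at `ℓ`, `cond(τ₁) = ∣d_{L0}∣/∣d_{F₃}∣`) — in-record (GEN 34) the factors were FE-sieved (K₂ not certified within 1 200 s; exactly one candidate FE-consistent), the ball is unchanged), `R~ = 3.23e19` (13 GRH units, maximal order proven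
`nfcertify = []`, kit j191173), `x = A/R~ = 4.000000… (ball radius 7.90e-38) vs h~ = 4`, `∣x − h~∣·R~/0.2052 ≤ 1.2e-17 < ½` ⇒ `h_R = k·h~`, `k = [U_R : μU~] ≤ 1.57e20` (Friedman);
(C2) residues of `⟨−1, u₁…u₁₃⟩` at 40 degree-one primes have `𝔽₅`-rank 13 / 14 (kit j191173) ⇒ `μU~` 5-saturated; hence `5 ∤ k`, so `5 ∤ h_R` (`h~ = 4`) and `Cl(R)[5] = Cl_S(R)[5] = 0`; (C3) the found `S`-units are 5-saturated in `R^×` (residues at 80 degree-one primes: `𝔽₅`-rank 33 / 34 columns, kit j193062) ⇒ `K(S,5)` IS the gen-14 space.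
Evidence chain: eng-cap-2 READ #1 / #2 (D- none), 0 DIFF vs the GEN 33 record; the pinned bytes + env are those REPRODUCED ball-for-ball by the non-author re-run on the three press rows (cc-eng-5 j213064 / j219359 / j219643); route 1 (PARI `lfun`, «never certified») agrees on every piece — ρ₀: in-record 96 b: ∣Δ∣ 1.43e-28 (r2 rad 8.41e-41) ✓, feq -110; ρ₀⊗σ₂: in-record 96 b (lfundiv): ∣Δ∣ 3.21e-28 (r2 rad 4.16e-38) ✓, feq ERR, w -I = ε; ψ²: route 1 (r1psi2 j208513 64 b feq -57): ∣Δ∣ 2.16e-18 ✓.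
On paper: characters ↔ representations, Artin formalism / class field theory, `Gal(ℚ(E[5])/ℚ) ≅ 5S4` per curve (image type + factor-pattern check);
PARI's exact layer (fields, `bnr`, `bnfcertify(L0) = 1`) is ONE implementation. This certificate line is UNCONDITIONAL GIVEN that certificate — its TIER is the referees' (R194.9 / R204; lit l.18036).
Binders: `hGZK`, `r_an ≤ 1`, `#Ш_an` a `5`-adic unit, `hSel`. Kernel: `Δ ≠ 0`.
[cite: Miller2011LMS, §1 and Def. 1.1] [cite: Cremona2006, Table 1 (Cremona label 110976o1)] -/
theorem bsdp_s110976o1 (hGZK : rank_eq_analyticRank_of_analyticRank_le_one)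
    (W : WeierstrassCurve ℚ) (hW : W = ⟨0, 1, 0, -130, -634⟩)
    (hr : W.analyticRank ≤ 1) {q : ℚ} (hq : shaAn W = (q : ℂ)) (hv : padicValRat 5 q = 0)
    (hSel : Nat.card (W.selmerGroup (5 : ℤ)) = 5 ^ W.analyticRank) : BSDp W 5 := by
  subst hW
  haveI : Fact (Nat.Prime 5) := ⟨by norm_num⟩
  exact bsdp_of_ainvs_of_card_selmerGroup hGZK 0 1 0 (-130) (-634) (by decide +kernel) 5
    hr hq hv hSel

/-- **`BSD(E,5)` for `110976v1`** (`N = 110976 = 2⁷·3·17²`, good ordinary at `5`, class X9; Cremona model `[0, 1, 0, -37666, 2889026]`; `ρ̄_{E,5}` of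
EXCEPTIONAL type `5S4`; rank `1`, `#Ш_an = 1`; c₂ = 1 (II), c₃ = 5 (I5), c₁₇ = 3 (IV*)). Heegner-index route of record:
JETCHEV–CHA (`D = -191`, `m = 30`, `ord₅ m = 1` = `ord₅` of exactly one Tamagawa number; flag `Miller11-Thm54-Cha-case`) — FLAG-FREE here. Here a SECOND, INDEPENDENT method for the same pair: GZK and the certificate line
`#Sel^(5)(E/ℚ) = 5 ^ r_an` — full `5`-descent over `R = ℚ(E[5]∖0)` (degree `24`; x11c gen-13 engine `s4desc`, byte copies;
run of record + independent verifier by unit `b2b-bsdres-x9` gen 14, kit j117662; certificate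
`HOME/b2b-bsdres-x9/g14/desc5s4/j117662/certs/cert_110976v1.txt.gz`): `S = [2, 3, 5, 17]`, `#gens R(S,5) = 29`, `5`-saturation
`[1, 63, 29]`, `dim K_S(R) = 1`, all local images complete, Galois action proved by characters,
**`dim_𝔽₅ Sel^(5)(E/ℚ) = 1`** with the Kummer image of the generator `[[-193,1734]]` its non-zero element (exact 5th root exhibited / in Fake / non-zero); verifier: VERIFIED; class group used: `Cl(R) = [2, [2]]`, `Cl_S(R) = [1, []]`
from `bnfinit` UNDER GRH (Zimmert bound `6.37e13` out of reach) — made GRH-FREE by the **ARTIN-SPLIT ANALYTIC CERTIFICATE** (X9-CENSUS-G32 §2):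
(C1) `A = h_R·R_R = 93874951767891842.349585… ± 5.61e-20` certified (route 2: Arb, kit j207803, pinned bundle `e8d67147…`, ONE env; `ζ_R = ζ_{L0}·L(ψ)L(ψ²)L(ψ³)`,
`Ind ψ ≅ ρ₀ ⊕ Ind λ` — kernel group layer `X9/ArtinSplit5S4Certificate` + `…Reduction`; `ψ²` piece `∣L(1,τ₁)∣²` with EXACT Euler factors since x9 GEN 36: `τ₁ ≅ (ζ_{L0}/ζ_{F₃}) ⊗ ε` (`F₃` the cubic subfield of `L0`, `ε` the quartic Dirichlet character mod 5 with `ε(2) = i`; kernel identity `X9/ArtinSplit5S4Tau1Twist`, per-row check kit j238441: the exact additive factors EQUAL the in-record FE-sieved choice, split the `bnr` factor of `Ind ψ²`, match the class table at every good `p ≤ 3000` and at `ℓ`, `cond(τ₁) = ∣d_{L0}∣/∣d_{F₃}∣`) — in-record (GEN 34) the factors were FE-sieved (K₂ not certified within 1 200 s; exactly one candidate FE-consistent), the ball is unchanged), `R~ = 4.69e16` (13 GRH units, maximal order proven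
`nfcertify = []`, kit j191164), `x = A/R~ = 2.000000… (ball radius 2.81e-37) vs h~ = 2`, `∣x − h~∣·R~/0.2052 ≤ 6.4e-20 < ½` ⇒ `h_R = k·h~`, `k = [U_R : μU~] ≤ 2.29e17` (Friedman);
(C2) residues of `⟨−1, u₁…u₁₃⟩` at 40 degree-one primes have `𝔽₅`-rank 13 / 14 (kit j191164) ⇒ `μU~` 5-saturated; hence `5 ∤ k`, so `5 ∤ h_R` (`h~ = 2`) and `Cl(R)[5] = Cl_S(R)[5] = 0`; (C3) the found `S`-units are 5-saturated in `R^×` (residues at 80 degree-one primes: `𝔽₅`-rank 29 / 30 columns, kit j193062) ⇒ `K(S,5)` IS the gen-14 space.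
Evidence chain: eng-cap-2 READ #1 / #2 (D- none), 0 DIFF vs the GEN 33 record; the pinned bytes + env are those REPRODUCED ball-for-ball by the non-author re-run on the three press rows (cc-eng-5 j213064 / j219359 / j219643); route 1 (PARI `lfun`, «never certified») agrees on every piece — ρ₀: in-record 96 b: ∣Δ∣ 3.26e-28 (r2 rad 8.53e-41) ✓, feq -107; ρ₀⊗σ₂: in-record 96 b (lfundiv): ∣Δ∣ 3.96e-29 (r2 rad 8.64e-38) ✓, feq -112, w -1 = ε; ψ²: route 1 (r1psi2 j208515 64 b feq -57): ∣Δ∣ 2.16e-18 ✓.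
On paper: characters ↔ representations, Artin formalism / class field theory, `Gal(ℚ(E[5])/ℚ) ≅ 5S4` per curve (image type + factor-pattern check);
PARI's exact layer (fields, `bnr`, `bnfcertify(L0) = 1`) is ONE implementation. This certificate line is UNCONDITIONAL GIVEN that certificate — its TIER is the referees' (R194.9 / R204; lit l.18036).
Binders: `hGZK`, `r_an ≤ 1`, `#Ш_an` a `5`-adic unit, `hSel`. Kernel: `Δ ≠ 0`.
[cite: Miller2011LMS, §1 and Def. 1.1] [cite: Cremona2006, Table 1 (Cremona label 110976v1)] -/
theorem bsdp_s110976v1 (hGZK : rank_eq_analyticRank_of_analyticRank_le_one)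
    (W : WeierstrassCurve ℚ) (hW : W = ⟨0, 1, 0, -37666, 2889026⟩)
    (hr : W.analyticRank ≤ 1) {q : ℚ} (hq : shaAn W = (q : ℂ)) (hv : padicValRat 5 q = 0)
    (hSel : Nat.card (W.selmerGroup (5 : ℤ)) = 5 ^ W.analyticRank) : BSDp W 5 := by
  subst hW
  haveI : Fact (Nat.Prime 5) := ⟨by norm_num⟩
  exact bsdp_of_ainvs_of_card_selmerGroup hGZK 0 1 0 (-37666) 2889026 (by decide +kernel) 5
    hr hq hv hSel

/-- **`BSD(E,5)` for `155682e1`** (`N = 155682 = 2·3⁴·31²`, good ordinary at `5`, class X9; Cremona model `[1, -1, 1, -39101, 1943397]`; `ρ̄_{E,5}` of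
EXCEPTIONAL type `5S4`; rank `0`, `#Ш_an = 1`; c₂ = 5 (I5), c₃ = 1 (II), c₃₁ = 3 (IV*)). Heegner-index route of record:
JETCHEV–CHA (`D = -23`, `m = 30`, `ord₅ m = 1` = `ord₅` of exactly one Tamagawa number; flag `Miller11-Thm54-Cha-case`) — FLAG-FREE here. Here a SECOND, INDEPENDENT method for the same pair: GZK and the certificate line
`#Sel^(5)(E/ℚ) = 5 ^ r_an` — full `5`-descent over `R = ℚ(E[5]∖0)` (degree `24`; x11c gen-13 engine `s4desc`, byte copies;
run of record + independent verifier by unit `b2b-bsdres-x9` gen 14, kit j117661; certificate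
`HOME/b2b-bsdres-x9/g14/desc5s4/j117661/certs/cert_155682e1.txt.gz`): `S = [2, 3, 5, 31]`, `#gens R(S,5) = 30`, `5`-saturation
`[1, 78, 30]`, `dim K_S(R) = 0`, all local images complete, Galois action proved by characters,
**`dim_𝔽₅ Sel^(5)(E/ℚ) = 0`**; verifier: VERIFIED; class group used: `Cl(R) = [3, [3]]`, `Cl_S(R) = [1, []]`
from `bnfinit` UNDER GRH (Zimmert bound `1.95e13` out of reach) — made GRH-FREE by the **ARTIN-SPLIT ANALYTIC CERTIFICATE** (X9-CENSUS-G32 §2):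
(C1) `A = h_R·R_R = 34687039566313976.605541… ± 4.19e-22` certified (route 2: Arb, kit j207797, pinned bundle `e8d67147…`, ONE env; `ζ_R = ζ_{L0}·L(ψ)L(ψ²)L(ψ³)`,
`Ind ψ ≅ ρ₀ ⊕ Ind λ` — kernel group layer `X9/ArtinSplit5S4Certificate` + `…Reduction`; `ψ²` piece `∣L(1,τ₁)∣²` with EXACT Euler factors since x9 GEN 36: `τ₁ ≅ (ζ_{L0}/ζ_{F₃}) ⊗ ε` (`F₃` the cubic subfield of `L0`, `ε` the quartic Dirichlet character mod 5 with `ε(2) = i`; kernel identity `X9/ArtinSplit5S4Tau1Twist`, per-row check kit j238441: the exact additive factors EQUAL the in-record FE-sieved choice, split the `bnr` factor of `Ind ψ²`, match the class table at every good `p ≤ 3000` and at `ℓ`, `cond(τ₁) = ∣d_{L0}∣/∣d_{F₃}∣`) — in-record (GEN 34) the factors were FE-sieved (K₂ not certified within 1 200 s; exactly one candidate FE-consistent), the ball is unchanged), `R~ = 1.16e16` (13 GRH units, maximal order proven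
`nfcertify = []`, kit j191159), `x = A/R~ = 3.000000… (ball radius 1.11e-38) vs h~ = 3`, `∣x − h~∣·R~/0.2052 ≤ 6.2e-22 < ½` ⇒ `h_R = k·h~`, `k = [U_R : μU~] ≤ 5.63e16` (Friedman);
(C2) residues of `⟨−1, u₁…u₁₃⟩` at 40 degree-one primes have `𝔽₅`-rank 13 / 14 (kit j191159) ⇒ `μU~` 5-saturated; hence `5 ∤ k`, so `5 ∤ h_R` (`h~ = 3`) and `Cl(R)[5] = Cl_S(R)[5] = 0`; (C3) the found `S`-units are 5-saturated in `R^×` (residues at 80 degree-one primes: `𝔽₅`-rank 30 / 31 columns, kit j193062) ⇒ `K(S,5)` IS the gen-14 space.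
Evidence chain: eng-cap-2 READ #1 / #2 (D- none), 0 DIFF vs the GEN 33 record; NON-AUTHOR RE-RUN cc-eng-5 kit j219643 from a clean copy of the pin REPRODUCES this record ball-for-ball (every certified ball and exact field SAME); route 1 (PARI `lfun`, «never certified») agrees on every piece — ρ₀: in-record 96 b: ∣Δ∣ 4.26e-29 (r2 rad 6.33e-44) ✓, feq -108; ρ₀⊗σ₂: in-record 96 b (lfundiv): ∣Δ∣ 3.90e-29 (r2 rad 5.58e-39) ✓, feq -112, w -I = ε; ψ²: route 1 (r1psi2 j208516 64 b feq -52): ∣Δ∣ 7.98e-19 ✓.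
On paper: characters ↔ representations, Artin formalism / class field theory, `Gal(ℚ(E[5])/ℚ) ≅ 5S4` per curve (image type + factor-pattern check);
PARI's exact layer (fields, `bnr`, `bnfcertify(L0) = 1`) is ONE implementation. This certificate line is UNCONDITIONAL GIVEN that certificate — its TIER is the referees' (R194.9 / R204; lit l.18036).
Binders: `hGZK`, `r_an ≤ 1`, `#Ш_an` a `5`-adic unit, `hSel`. Kernel: `Δ ≠ 0`.
[cite: Miller2011LMS, §1 and Def. 1.1] [cite: Cremona2006, Table 1 (Cremona label 155682e1)] -/
theorem bsdp_s155682e1 (hGZK : rank_eq_analyticRank_of_analyticRank_le_one)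
    (W : WeierstrassCurve ℚ) (hW : W = ⟨1, -1, 1, -39101, 1943397⟩)
    (hr : W.analyticRank ≤ 1) {q : ℚ} (hq : shaAn W = (q : ℂ)) (hv : padicValRat 5 q = 0)
    (hSel : Nat.card (W.selmerGroup (5 : ℤ)) = 5 ^ W.analyticRank) : BSDp W 5 := by
  subst hW
  haveI : Fact (Nat.Prime 5) := ⟨by norm_num⟩
  exact bsdp_of_ainvs_of_card_selmerGroup hGZK 1 (-1) 1 (-39101) 1943397 (by decide +kernel) 5
    hr hq hv hSel

/-- **`BSD(E,5)` for `184512e1`** (`N = 184512 = 2⁶·3·31²`, good ordinary at `5`, class X9; Cremona model `[0, 1, 0, 2701051, 21476936547]`; `ρ̄_{E,5}` of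
EXCEPTIONAL type `5S4`; rank `1`, `#Ш_an = 1`; c₂ = 1 (II*), c₃ = 15 (I15), c₃₁ = 3 (IV*)). Heegner-index route of record:
JETCHEV–CHA (`D = -23`, `m = 180`, `ord₅ m = 1` = `ord₅` of exactly one Tamagawa number; flag `Miller11-Thm54-Cha-case`) — FLAG-FREE here. Here a SECOND, INDEPENDENT method for the same pair: GZK and the certificate line
`#Sel^(5)(E/ℚ) = 5 ^ r_an` — full `5`-descent over `R = ℚ(E[5]∖0)` (degree `24`; x11c gen-13 engine `s4desc`, byte copies;
run of record + independent verifier by unit `b2b-bsdres-x9` gen 14, kit j117663; certificate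
`HOME/b2b-bsdres-x9/g14/desc5s4/j117663/certs/cert_184512e1.txt.gz`): `S = [2, 3, 5, 31]`, `#gens R(S,5) = 30`, `5`-saturation
`[1, 78, 30]`, `dim K_S(R) = 0`, all local images complete, Galois action proved by characters,
**`dim_𝔽₅ Sel^(5)(E/ℚ) = 1`** with the Kummer image of the generator `[[13774,1634661]]` its non-zero element (exact 5th root exhibited / in Fake / non-zero); verifier: VERIFIED; class group used: `Cl(R) = [45, [15, 3]]`, `Cl_S(R) = [1, []]`
from `bnfinit` UNDER GRH (Zimmert bound `1.52e13` out of reach) — made GRH-FREE by the **ARTIN-SPLIT ANALYTIC CERTIFICATE** (X9-CENSUS-G32 §2):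
(C1) `A = h_R·R_R = 27795066227644278.899928… ± 5.49e-22` certified (route 2: Arb, kit j207803, pinned bundle `e8d67147…`, ONE env; `ζ_R = ζ_{L0}·L(ψ)L(ψ²)L(ψ³)`,
`Ind ψ ≅ ρ₀ ⊕ Ind λ` — kernel group layer `X9/ArtinSplit5S4Certificate` + `…Reduction`; `ψ²` piece EXACT: `bnfcertify(K₂) = 1` in-record, three-way agreement with `∣L(1,τ₁)∣²` and PARI), `R~ = 6.18e14` (13 GRH units, maximal order proven
`nfcertify = []`, kit j191164), `x = A/R~ = 45.000000… (ball radius 1.43e-37) vs h~ = 45`, `∣x − h~∣·R~/0.2052 ≤ 4.3e-22 < ½` ⇒ `h_R = k·h~`, `k = [U_R : μU~] ≤ 3.01e15` (Friedman);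
(C2) residues of `⟨−1, u₁…u₁₃⟩` at 40 degree-one primes have `𝔽₅`-rank 13 / 14 (kit j191164) ⇒ `μU~` 5-saturated; hence `5 ∤ k`, so `v₅(h_R) = v₅(h~) = 1` (`h~ = 45`); (C3) kit j193062: `A := g₁^3` has `A⁵ = (α)` (exact), residue rank of `⟨−1, uᵢ, α⟩` = 14 ⇒ `[A]` has order exactly 5, and `A·∏𝔭ᵢ^(−eᵢ) = (β)` (exact, `e = [0, 3, 0, 0, 0, 0, 0, 0, 0, 0, 0, 0, 0, 0, 0, 0, 0]` on the `S`-primes) ⇒ `Cl(R)[5^∞] = ⟨[A]⟩ ⊂ ⟨S-primes⟩` ⇒ `Cl_S(R)[5] = 0`; the found `S`-units are 5-saturated (rank 30 / 31) ⇒ `K(S,5)` IS the gen-14 space.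
Evidence chain: eng-cap-2 READ #1 / #2 (D- none), 0 DIFF vs the GEN 33 record; the pinned bytes + env are those REPRODUCED ball-for-ball by the non-author re-run on the three press rows (cc-eng-5 j213064 / j219359 / j219643); route 1 (PARI `lfun`, «never certified») agrees on every piece — ρ₀: in-record 96 b: ∣Δ∣ 1.27e-28 (r2 rad 5.41e-39) ✓, feq -109; ρ₀⊗σ₂: in-record 96 b (lfundiv): ∣Δ∣ 3.15e-29 (r2 rad 6.91e-40) ✓, feq -112, w -I = ε; ψ²: exact (K₂ cert in-record): ∣Δ∣ 4.78e-37 ✓; route 1 (in-record 64 b): ∣Δ∣ 4.18e-18 ✓.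
On paper: characters ↔ representations, Artin formalism / class field theory, `Gal(ℚ(E[5])/ℚ) ≅ 5S4` per curve (image type + factor-pattern check);
PARI's exact layer (fields, `bnr`, `bnfcertify(L0) = 1`) is ONE implementation. This certificate line is UNCONDITIONAL GIVEN that certificate — its TIER is the referees' (R194.9 / R204; lit l.18036).
Binders: `hGZK`, `r_an ≤ 1`, `#Ш_an` a `5`-adic unit, `hSel`. Kernel: `Δ ≠ 0`.
[cite: Miller2011LMS, §1 and Def. 1.1] [cite: Cremona2006, Table 1 (Cremona label 184512e1)] -/
theorem bsdp_s184512e1 (hGZK : rank_eq_analyticRank_of_analyticRank_le_one)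
    (W : WeierstrassCurve ℚ) (hW : W = ⟨0, 1, 0, 2701051, 21476936547⟩)
    (hr : W.analyticRank ≤ 1) {q : ℚ} (hq : shaAn W = (q : ℂ)) (hv : padicValRat 5 q = 0)
    (hSel : Nat.card (W.selmerGroup (5 : ℤ)) = 5 ^ W.analyticRank) : BSDp W 5 := by
  subst hW
  haveI : Fact (Nat.Prime 5) := ⟨by norm_num⟩
  exact bsdp_of_ainvs_of_card_selmerGroup hGZK 0 1 0 2701051 21476936547 (by decide +kernel) 5
    hr hq hv hSel

/-- **`BSD(E,5)` for `203136s1`** (`N = 203136 = 2⁷·3·23²`, good ordinary at `5`, class X9; Cremona model `[0, 1, 0, -2269, -54757]`; `ρ̄_{E,5}` of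
EXCEPTIONAL type `5S4`; rank `1`, `#Ш_an = 1`; c₂ = 2 (III*), c₃ = 10 (I10), c₂₃ = 1 (II)). Heegner-index route of record:
JETCHEV–CHA (`D = -143`, `m = 40`, `ord₅ m = 1` = `ord₅` of exactly one Tamagawa number; flag `Miller11-Thm54-Cha-case`) — FLAG-FREE here. Here a SECOND, INDEPENDENT method for the same pair: GZK and the certificate line
`#Sel^(5)(E/ℚ) = 5 ^ r_an` — full `5`-descent over `R = ℚ(E[5]∖0)` (degree `24`; x11c gen-13 engine `s4desc`, byte copies;
run of record + independent verifier by unit `b2b-bsdres-x9` gen 14, kit j117663; certificate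
`HOME/b2b-bsdres-x9/g14/desc5s4/j117663/certs/cert_203136s1.txt.gz`): `S = [2, 3, 5, 23]`, `#gens R(S,5) = 27`, `5`-saturation
`[1, 234, 27]`, `dim K_S(R) = 0`, all local images complete, Galois action proved by characters,
**`dim_𝔽₅ Sel^(5)(E/ℚ) = 1`** with the Kummer image of the generator `[[161,1944]]` its non-zero element (exact 5th root exhibited / in Fake / non-zero); verifier: VERIFIED; class group used: `Cl(R) = [10, [10]]`, `Cl_S(R) = [1, []]`
from `bnfinit` UNDER GRH (Zimmert bound `3.78e17` out of reach) — made GRH-FREE by the **ARTIN-SPLIT ANALYTIC CERTIFICATE** (X9-CENSUS-G32 §2):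
(C1) `A = h_R·R_R = 509581032240788761058.340997… ± 6.88e-16` certified (route 2: Arb, kit j207801, pinned bundle `e8d67147…`, ONE env; `ζ_R = ζ_{L0}·L(ψ)L(ψ²)L(ψ³)`,
`Ind ψ ≅ ρ₀ ⊕ Ind λ` — kernel group layer `X9/ArtinSplit5S4Certificate` + `…Reduction`; `ψ²` piece `∣L(1,τ₁)∣²` with EXACT Euler factors since x9 GEN 36: `τ₁ ≅ (ζ_{L0}/ζ_{F₃}) ⊗ ε` (`F₃` the cubic subfield of `L0`, `ε` the quartic Dirichlet character mod 5 with `ε(2) = i`; kernel identity `X9/ArtinSplit5S4Tau1Twist`, per-row check kit j238441: the exact additive factors EQUAL the in-record FE-sieved choice, split the `bnr` factor of `Ind ψ²`, match the class table at every good `p ≤ 3000` and at `ℓ`, `cond(τ₁) = ∣d_{L0}∣/∣d_{F₃}∣`) — in-record (GEN 34) the factors were FE-sieved (K₂ not certified within 1 200 s; exactly one candidate FE-consistent), the ball is unchanged), `R~ = 5.1e19` (13 GRH units, maximal order proven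
`nfcertify = []`, kit j191166), `x = A/R~ = 10.000000… (ball radius 5.35e-36) vs h~ = 10`, `∣x − h~∣·R~/0.2052 ≤ 1.3e-15 < ½` ⇒ `h_R = k·h~`, `k = [U_R : μU~] ≤ 2.48e20` (Friedman);
(C2) residues of `⟨−1, u₁…u₁₃⟩` at 40 degree-one primes have `𝔽₅`-rank 13 / 14 (kit j191166) ⇒ `μU~` 5-saturated; hence `5 ∤ k`, so `v₅(h_R) = v₅(h~) = 1` (`h~ = 10`); (C3) kit j193062: `A := g₁^2` has `A⁵ = (α)` (exact), residue rank of `⟨−1, uᵢ, α⟩` = 14 ⇒ `[A]` has order exactly 5, and `A·∏𝔭ᵢ^(−eᵢ) = (β)` (exact, `e = [0, 4, 0, 0, 0, 0, 0, 0, 0, 0, 0, 0, 0, 8]` on the `S`-primes) ⇒ `Cl(R)[5^∞] = ⟨[A]⟩ ⊂ ⟨S-primes⟩` ⇒ `Cl_S(R)[5] = 0`; the found `S`-units are 5-saturated (rank 27 / 28) ⇒ `K(S,5)` IS the gen-14 space.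
Evidence chain: eng-cap-2 READ #1 / #2 (D- none), 0 DIFF vs the GEN 33 record; the pinned bytes + env are those REPRODUCED ball-for-ball by the non-author re-run on the three press rows (cc-eng-5 j213064 / j219359 / j219643); route 1 (PARI `lfun`, «never certified») agrees on every piece — ρ₀: in-record 96 b: ∣Δ∣ 1.23e-28 (r2 rad 7.52e-37) ✓, feq -107; ρ₀⊗σ₂: r1big j208459 96 b: quotient psiA passes (feq -116, w = 1 = ε), ∣Δ∣ 2.52e-28 (r2 rad 6.50e-40) ✓; other quotient feq -5; ψ²: route 1 (r1psi2 j208518 64 b feq -52): ∣Δ∣ 3.12e-18 ✓.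
On paper: characters ↔ representations, Artin formalism / class field theory, `Gal(ℚ(E[5])/ℚ) ≅ 5S4` per curve (image type + factor-pattern check);
PARI's exact layer (fields, `bnr`, `bnfcertify(L0) = 1`) is ONE implementation. This certificate line is UNCONDITIONAL GIVEN that certificate — its TIER is the referees' (R194.9 / R204; lit l.18036).
Binders: `hGZK`, `r_an ≤ 1`, `#Ш_an` a `5`-adic unit, `hSel`. Kernel: `Δ ≠ 0`.
[cite: Miller2011LMS, §1 and Def. 1.1] [cite: Cremona2006, Table 1 (Cremona label 203136s1)] -/
theorem bsdp_s203136s1 (hGZK : rank_eq_analyticRank_of_analyticRank_le_one)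
    (W : WeierstrassCurve ℚ) (hW : W = ⟨0, 1, 0, -2269, -54757⟩)
    (hr : W.analyticRank ≤ 1) {q : ℚ} (hq : shaAn W = (q : ℂ)) (hv : padicValRat 5 q = 0)
    (hSel : Nat.card (W.selmerGroup (5 : ℤ)) = 5 ^ W.analyticRank) : BSDp W 5 := by
  subst hW
  haveI : Fact (Nat.Prime 5) := ⟨by norm_num⟩
  exact bsdp_of_ainvs_of_card_selmerGroup hGZK 0 1 0 (-2269) (-54757) (by decide +kernel) 5
    hr hq hv hSel

end Summit.BirchSwinnertonDyer.Rank1Residual.X9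

end
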